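import Summits.Schanuel.Schanuel.Theorems.RootDecomp1KArcCell06

/-!
# RootDecomp1KArcCell — lens 1, generation 50, node 9 «THE ARC ENGINE: separation by positive-dimensional containment; members ρ° = Π(1+4^(−k!)) and the twin σ° = Π(1+2·4^(−k!)); item 33364 decided hyp-free at zA = (1, ℓ₂, ρ°), zD = (1, ρ°, σ°) and π-twins» — continuation (RootDecomp1KArcCell07): §7a the one 2-adic cut and the form lower bound at zA, the 33364 instances

(lens-1 g50 HOME kernel K = HOME/decomp-schanuel-lens-1/g50/ArcCell.lean 10f1e0d5…, 3410 l · 258 decl lines, imports …RootDecomp1KCollarWall05 + …RootDecomp1KCommonRadixCell04 + …RootDecomp1KNWMeasureHolds BY NAME; P ArcCellProbe.lean af7624ff… rc 0 / C₀ ArcCellCtrl0.lean d71f613e… rc 0 / C ArcCellCtrl.lean 242a3b02… rc 1 = 42 planted; memo NODE-g50.md; CLAIM L2466, EX-ANTE PRICE + CHECKLIST K-g50 L2467, NODE L2469 / REQUEST L2470 (with the lens's ex-post self-correction: both members fall to printed dominance in substance — zA directly by Bundschuh LNM 1415 p.78 / Zhu 推论 1.3.3, zD after τ = σ°/ρ°²);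 critic VERDICT L2473: CLEARED AS PRICED EX ANTE — ONE CELL ×1 «ARC CELL (TYPED-LEVEL)» with the SUBSTANCE CAVEAT OF RECORD (both members inside the archimedean dominance class in substance; E2 convenient, not necessary), RULE K-R39 FIXED, PORT GO. Port by census-1 gen 21 as `RootDecomp1KArcCell01–13` along K's §1–§12 with §4, §7 and §12 cut at decl boundaries by the 400-line file cap: 01 = §1 (E1) `aeval_one_div_two_pow_ne_zero` (dyadic root lemma) + §2 (E2) `toPolyPoly`, `arc_count` (a relation contains ≤ deg q of an injective family of rational arcs — roots over the domain ℚ[X]); 02 = §3 (A) the member: `dfac`, `arcNum`, `arcProdQ` (ρ°_N), `sQ`, `rhoArc` (ρ° = Π(1 + 4^(−k!))) and its tails; 03 = §4a (E3) `TruncGenericSeq` («[class] definition» tag) + **`algebraicIndependent_of_truncGenericSeq`** (the g36/g37 extraction re-plumbed to arbitrary dyadic-type schedules); 04 = §4b `psQ`, the link `truncGeneric_iff_truncGenericSeq` and the tree (X′) re-derived — K's `theorem algebraicIndependent_liouville_of_truncGeneric'` DEMOTED to a documented `example` (its statement is byte-identical to the tree's `RootDecomp1KCommonRadixCell.algebraicIndependent_liouville_of_truncGeneric`,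 CommonRadixCell03 l.98 — dedup twin flagged by the writer L2472 (α), demotion pre-sanctioned by the critic L2473; nothing in K uses the primed name); 05 = §5 the arcs of ρ°: `arcPoly`, `arcF`, `arcBasis`, `arcScal`, `clearArc`, `truncGenericSeq_arc`, tightness `qArc` / `qArc_tight`; 06 = §6 the arc cell `algebraicIndependent_arc_of_mvPolyMeasure`, `algebraicIndependent_rhoArc_ell2`, walls `sb_arcWall3(_pi)`, item-shape instances + §7 head `zA` / `zApi`, `linearIndependent_zA(pi)`, `linLiouville_zA(pi)`; 07 = §7a the ONE 2-adic cut `cutA` + **`form_lower_bound_A`** (exponent 9), `not_hyperLinLiouville_zA(pi)` (m₀ = 10), `sb_zA(pi)`, `finiteOrderLiouvilleSchanuel_at_zA(pi)`, `item33364_at_zA(pi)`, `item31077_at_zA`; 08 = §8 `rhoArc_position` (11 conjuncts by tree name) and its lemmas, `liouville_rhoArc`; 09 = §9 (A′) the twin σ° = Π(1 + 2·4^(−k!)): `arcNum2`, `arcOdd2`, `arcProdQ2`, `sigmaArc`, `liouville_sigmaArc`; 10 = §10 the lines of (ρ°, σ°): `linPoly`, `linF`, `linBasis`, `linScal`, `clearLin`,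 `truncGenericSeq_lin`, `qLin` / `qLin_tight`; 11 = §11 the twin cell `algebraicIndependent_twin_of_mvPolyMeasure`, walls `sb_twinWall3(_pi)`, item-shape instances + §12 head `zD` / `zDpi`, binders; 12 = §12a part 1 the archimedean two-level cut `cutD`, `cutD_succ_ne_zero`, `cutD_height_bound`; 13 = §12a part 2 **`form_lower_bound_D`** (exponent 7), `not_hyperLinLiouville_zD(pi)` (m₀ = 8), `sb_zD(pi)`, `item33364_at_zD(pi)`, `zD_shape`. PORT EDITS (census convention): `set_option linter.dupNamespace false` dropped; 77 one-line helper docstrings added (statements quoted); per-part private helper copies; sections `Extraction` / `Members` / `TwinMembers` closed and re-opened across the cuts with their `variable` / `open` lines; statements and proofs otherwise verbatim (no renames; K's own private markers kept). `--supports stmt-Schanuel-33364`; no census credit carried; rung 0 — nothing here proves Schanuel; no ∀-item moves; 33364, 33363, 31077 stay OPEN.)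
-/

noncomputable section

open Polynomial LiouvilleNumber
open scoped Nat

namespace Summit.Schanuel.Schanuel.Theorems.RootDecomp1KArcCell

open Summit.Schanuel.Schanuel.Theorems.RootDecomp1KCollarCell
open Summit.Schanuel.Schanuel.Theorems.RootDecomp1KGapCell
open Summit.Schanuel.Schanuel.Theorems.RootDecomp1KTwoBaseCell
open Summit.Schanuel.Schanuel.Theorems.RootDecomp1KRelLiouvilleCell
open Summit.Schanuel.Schanuel.Theorems.RootDecomp1KNWMeasureHolds (polyMeasure_exp_one_holds)
open Summit.Schanuel.Schanuel.Theorems.RootDecomp1KHyper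
open Summit.Schanuel.Schanuel.Theorems.RootDecomp1KHyper.HyperCell
open Summit.Schanuel.Schanuel.Theorems.RootDecomp1KCommonRadixCell (TruncGeneric algebraicIndependent_liouville_of_truncGeneric)

section Members

open IntermediateField
open Summit.Schanuel.Schanuel.Theorems.RootDecomp1KCollarWall (cutInt_ne_zero)

/-! ### §7a  the ONE 2-adic cut at level `N` (resolution `2^{2D_N}`) and the form lower bound (M) -/

/-- The cut integer `I_N(g) = g₀·2^{2D_N} + g₂·ν_N + g₁·p_N·2^{2D_N − N!}` (`ν_N = arcNum N`, `p_N = psNumer 2 N`). -/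
def cutA (g : Fin 3 → ℤ) (N : ℕ) : ℤ :=
  g 0 * 2 ^ (2 * dfac N) + g 2 * (arcNum N : ℤ) + g 1 * (psNumer 2 N : ℤ) * 2 ^ (2 * dfac N - N !)

/-- `ρ°_N = ν_N / 2^{2D_N}` as a real number. -/
theorem arcProdQ_cast_eq (N : ℕ) : ((arcProdQ N : ℚ) : ℝ) = (arcNum N : ℝ) / (2 : ℝ) ^ (2 * dfac N) := by
  rw [arcProdQ_eq_div, pow_mul]
  push_cast
  norm_num

/-- The cut is the dyadic rational `I_N(g)/2^{2D_N}`: `g₀ + g₁ s_N + g₂ ρ°_N = I_N(g)/2^{2D_N}`. -/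
theorem cutA_eq (g : Fin 3 → ℤ) (N : ℕ) :
    (g 0 : ℝ) + g 1 * partialSum 2 N + g 2 * ((arcProdQ N : ℚ) : ℝ) = (cutA g N : ℝ) / (2 : ℝ) ^ (2 * dfac N) := by
  have hp : partialSum 2 N = (psNumer 2 N : ℝ) / 2 ^ N ! := by
    have := partialSum_eq_psNumer_div (by norm_num : 0 < 2) N
    push_cast at this
    exact this
  have hle : N ! ≤ 2 * dfac N := by have := factorial_le_dfac N; omega
  rw [hp, arcProdQ_cast_eq, cutA]
  push_cast
  rw [pow_sub₀ _ two_ne_zero hle]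
  field_simp
  ring

/-- **`I_N(g) ≠ 0`** whenever `g ≠ 0` and `|g₁|, |g₂| < 2^{N!}` — the tree's 2-adic divisibility lemma CollarWall04
`cutInt_ne_zero` BY NAME (`ν_N` odd: `odd_arcNum`; `p_N` odd: tree CollarCell02 `odd_psNumer_two`; `N! ≤ 2D_N − N!`:
`factorial_le_dfac`). -/
theorem cutA_ne_zero_of_small (g : Fin 3 → ℤ) {N : ℕ} (hN : 2 ≤ N) (hg : g ≠ 0) (h1 : |g 1| < 2 ^ N !)
    (h2 : |g 2| < 2 ^ N !) : cutA g N ≠ 0 := by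
  have hDN : N ! ≤ dfac N := factorial_le_dfac N
  set c : ℕ := 2 * dfac N - N ! with hc
  have hF : 2 * dfac N = c + N ! := by omega
  have hfc : N ! ≤ c := by omega
  have h2' : |g 2| < 2 ^ c := lt_of_lt_of_le h2 (pow_le_pow_right₀ (by norm_num) hfc)
  have hg' : ¬ (g 0 = 0 ∧ g 2 = 0 ∧ g 1 = 0) := by
    rintro ⟨h0, h2, h1⟩; apply hg; funext i; fin_cases i <;> simp [h0, h1, h2]
  have hodd : Odd (arcNum N : ℤ) := (odd_arcNum N).natCast
  have key := cutInt_ne_zero (g₀ := g 0) (hp := hodd) (hM := odd_psNumer_two hN) h2' h1 hg'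
  rw [cutA, hF, Nat.add_sub_cancel]
  exact key

/-- A non-vanishing cut is `≥` its resolution: `I_N(g) ≠ 0 ⇒ 2^{−2D_N} ≤ |g₀ + g₁ s_N + g₂ ρ°_N|`. -/
theorem cutA_lower (g : Fin 3 → ℤ) (N : ℕ) (hne : cutA g N ≠ 0) :
    1 / (2 : ℝ) ^ (2 * dfac N) ≤ |(g 0 : ℝ) + g 1 * partialSum 2 N + g 2 * ((arcProdQ N : ℚ) : ℝ)| := by
  rw [cutA_eq, abs_div, abs_of_pos (by positivity : (0 : ℝ) < 2 ^ (2 * dfac N))]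
  exact div_le_div_of_nonneg_right (by exact_mod_cast Int.one_le_abs hne) (by positivity)

/-- The cut's truncation error: `|φ(g) − Φ_N(g)| ≤ |g₁|·2/2^{(N+1)!} + |g₂|·8/2^{(N+1)!}` (tree RelLiouvilleCell03
`abs_liouvilleNumber_two_sub_partialSum`; `abs_rhoArc_sub_arcProdQ_le`). -/
theorem cutA_approx (g : Fin 3 → ℤ) (N : ℕ) :
    |((g 0 : ℝ) + g 1 * liouvilleNumber 2 + g 2 * rhoArc) -
      ((g 0 : ℝ) + g 1 * partialSum 2 N + g 2 * ((arcProdQ N : ℚ) : ℝ))| ≤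
      |(g 1 : ℝ)| * (2 / (2 : ℝ) ^ (N + 1)!) + |(g 2 : ℝ)| * (8 / (2 : ℝ) ^ (N + 1)!) := by
  have hr := abs_liouvilleNumber_two_sub_partialSum N
  have hρ := abs_rhoArc_sub_arcProdQ_le N
  have e : ((g 0 : ℝ) + g 1 * liouvilleNumber 2 + g 2 * rhoArc) -
      ((g 0 : ℝ) + g 1 * partialSum 2 N + g 2 * ((arcProdQ N : ℚ) : ℝ)) =
      g 1 * (liouvilleNumber 2 - partialSum 2 N) + g 2 * (rhoArc - arcProdQ N) := by ring
  rw [e]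
  calc |(g 1 : ℝ) * (liouvilleNumber 2 - partialSum 2 N) + g 2 * (rhoArc - arcProdQ N)|
      ≤ |(g 1 : ℝ)| * |liouvilleNumber 2 - partialSum 2 N| + |(g 2 : ℝ)| * |rhoArc - arcProdQ N| := by
        refine (abs_add_le _ _).trans ?_
        rw [abs_mul, abs_mul]
    _ ≤ |(g 1 : ℝ)| * (2 / (2 : ℝ) ^ (N + 1)!) + |(g 2 : ℝ)| * (8 / (2 : ℝ) ^ (N + 1)!) := by
        gcongr

/-- **The cut slack**: `N! + 2D_N + 5 ≤ (N+1)!` for `N ≥ 5` (`D_N ≤ 2N!`, `(N+1)! = (N+1)·N! ≥ 6N!`, `N! ≥ 5`). -/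
theorem cutA_slack {N : ℕ} (hN : 5 ≤ N) : N ! + 2 * dfac N + 5 ≤ (N + 1)! := by
  have hD := dfac_le N
  have h5 : 5 ≤ N ! := (Nat.self_le_factorial N).trans' hN
  have h6 : 6 * N ! ≤ (N + 1)! := by rw [Nat.factorial_succ]; exact Nat.mul_le_mul_right _ (by omega)
  omega

/-- **Minimality of the cut level bounds the resolution by the height**: if `5 ≤ N` and `2^{k!} ≤ H` for every `5 ≤ k < N`
(i.e. `N` is the LEAST level `≥ 5` with `H < 2^{N!}`) then `2D_N + 2 ≤ (1+H)^9` — for `N = 5`: `2·D_5 + 2 = 310 ≤ 512 = 2^9`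
(`D_5 = 154` by `norm_num [Nat.factorial]`); for `N ≥ 6`: `(N−1)! < 2^{(N−1)!} ≤ H`, so `N ≤ (N−1)! + 1 ≤ H` and
`N! = N·(N−1)! ≤ H²`, whence `2D_N + 2 ≤ 4N! + 2 ≤ 4H² + 2 ≤ (1+H)³ ≤ (1+H)^9`. -/
theorem cutA_height_bound {H N : ℕ} (hH : 1 ≤ H) (hN : 5 ≤ N) (hmin : ∀ k < N, 5 ≤ k → 2 ^ k ! ≤ H) :
    2 * dfac N + 2 ≤ (1 + H) ^ 9 := by
  have X2 : 2 ≤ 1 + H := by omega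
  rcases Nat.eq_or_lt_of_le hN with h5 | h6
  · subst h5
    have hD : dfac 5 = 154 := by norm_num [dfac, Finset.sum_range_succ, Nat.factorial]
    have h9 : 2 ^ 9 ≤ (1 + H) ^ 9 := Nat.pow_le_pow_left X2 9
    rw [hD]
    norm_num at h9
    omega
  · obtain ⟨M, rfl⟩ : ∃ M, N = M + 1 := ⟨N - 1, by omega⟩
    have hM5 : 5 ≤ M := by omega
    have hm := hmin M (by omega) hM5
    have hfac : M ! < H := lt_of_lt_of_le Nat.lt_two_pow_self hm
    have hN_le : M + 1 ≤ H := by have := Nat.self_le_factorial M; omega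
    have hfacN : (M + 1)! ≤ H * H := by
      rw [Nat.factorial_succ]; exact Nat.mul_le_mul hN_le hfac.le
    have hD := dfac_le (M + 1)
    calc 2 * dfac (M + 1) + 2 ≤ 4 * (H * H) + 2 := by omega
      _ ≤ (1 + H) ^ 3 := by nlinarith [hH]
      _ ≤ (1 + H) ^ 9 := Nat.pow_le_pow_right (by omega) (by norm_num)

/-- **(M) THE ONE-CUT 2-ADIC FORM BOUND** — the quantitative opposite of `HyperLinLiouville` at the arc member:
for every integer vector `g ≠ 0`, `exp(−(1+Σ|gᵢ|)^9) ≤ |g₀ + g₁ℓ₂ + g₂ρ°|`.  With `H = Σ|gᵢ|` and `N` the LEAST level `≥ 5`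
with `H < 2^{N!}`, cut BOTH coordinates at the single resolution `2^{2D_N}`: `2^{2D_N}·(g₀ + g₁ s_N + g₂ ρ°_N) = I_N(g)` is a
NON-ZERO integer (`cutA_ne_zero_of_small`), the truncation error is `≤ 10·H/2^{(N+1)!} ≤ ½·2^{−2D_N}` by `cutA_slack`, so
`|φ(g)| ≥ 2^{−2D_N−1}`, and minimality gives `2D_N + 2 ≤ (1+H)^9` (`cutA_height_bound`; `log 2 ≤ 1`).  The exponent `9` is a
literal fixed after the build (floor case `N = 5`: `2·154 + 2 ≤ 2^9`). -/
theorem form_lower_bound_A (g : Fin 3 → ℤ) (hg : g ≠ 0) :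
    Real.exp (-((1 + ∑ i, (|g i| : ℝ)) ^ 9)) ≤
      |(g 0 : ℝ) + g 1 * liouvilleNumber 2 + g 2 * rhoArc| := by
  classical
  set HR : ℝ := ∑ i, (|g i| : ℝ) with hHR
  set Hn : ℕ := ∑ i, (g i).natAbs with hHn
  have hHRn : HR = (Hn : ℝ) := by
    rw [hHR, hHn, Nat.cast_sum]
    refine Finset.sum_congr rfl fun i _ => ?_
    simp only [Nat.cast_natAbs, Int.cast_abs]
  have hgi : ∀ i, (g i).natAbs ≤ Hn := fun i =>
    Finset.single_le_sum (f := fun i => (g i).natAbs) (fun _ _ => Nat.zero_le _) (Finset.mem_univ i)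
  have hHn1 : 1 ≤ Hn := by
    obtain ⟨i, hi⟩ := Function.ne_iff.mp hg
    have hi' : g i ≠ 0 := by simpa using hi
    exact le_trans (Nat.one_le_iff_ne_zero.mpr (Int.natAbs_ne_zero.mpr hi')) (hgi i)
  -- the cut level: `N` least with `5 ≤ N ∧ Hn < 2^{N!}`
  have hex : ∃ N : ℕ, 5 ≤ N ∧ Hn < 2 ^ N ! := by
    refine ⟨max 5 Hn, le_max_left _ _, Nat.lt_two_pow_self.trans_le (Nat.pow_le_pow_right (by norm_num) ?_)⟩
    exact (le_max_right 5 Hn).trans (Nat.self_le_factorial _)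
  set N : ℕ := Nat.find hex with hN
  have hNspec : 5 ≤ N ∧ Hn < 2 ^ N ! := Nat.find_spec hex
  have hNmin : ∀ k < N, 5 ≤ k → 2 ^ k ! ≤ Hn := fun k hk hk5 => by
    have h1 : ¬ (5 ≤ k ∧ Hn < 2 ^ k !) := Nat.find_min hex hk
    rw [not_and, not_lt] at h1
    exact h1 hk5
  have hN5 : 5 ≤ N := hNspec.1
  set F : ℕ := 2 * dfac N with hF
  -- `|g₁|, |g₂| ≤ Hn < 2^{N!}`
  have hsmall : ∀ i, |g i| < 2 ^ N ! := fun i => by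
    have h1 : (((g i).natAbs : ℕ) : ℤ) < 2 ^ N ! := by exact_mod_cast (hgi i).trans_lt hNspec.2
    rwa [Int.natCast_natAbs] at h1
  have hI : cutA g N ≠ 0 := cutA_ne_zero_of_small g (by omega) hg (hsmall 1) (hsmall 2)
  have hlow := cutA_lower g N hI
  have happ := cutA_approx g N
  -- the truncation error is at most half the resolution
  have hs : N ! + F + 5 ≤ (N + 1)! := cutA_slack hN5
  have hgiR : ∀ i, |(g i : ℝ)| ≤ (Hn : ℝ) := fun i => by
    have h1 : (((g i).natAbs : ℕ) : ℝ) ≤ Hn := by exact_mod_cast hgi i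
    rwa [Nat.cast_natAbs, Int.cast_abs] at h1
  have hHnR : (Hn : ℝ) ≤ (2 : ℝ) ^ N ! := by exact_mod_cast hNspec.2.le
  have heps : |(g 1 : ℝ)| * (2 / (2 : ℝ) ^ (N + 1)!) + |(g 2 : ℝ)| * (8 / (2 : ℝ) ^ (N + 1)!) ≤
      1 / (2 : ℝ) ^ F / 2 := by
    have b1 : (1 : ℝ) / 2 ^ (N + 1)! ≤ 1 / 2 ^ (N ! + F + 5) :=
      one_div_le_one_div_of_le (by positivity) (pow_le_pow_right₀ (by norm_num) hs)
    have hsplit : (2 : ℝ) ^ (N ! + F + 5) = 2 ^ N ! * 2 ^ F * 32 := by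
      rw [pow_add, pow_add]; norm_num
    calc |(g 1 : ℝ)| * (2 / (2 : ℝ) ^ (N + 1)!) + |(g 2 : ℝ)| * (8 / (2 : ℝ) ^ (N + 1)!)
        = (2 * |(g 1 : ℝ)| + 8 * |(g 2 : ℝ)|) * (1 / 2 ^ (N + 1)!) := by ring
      _ ≤ (2 * (Hn : ℝ) + 8 * Hn) * (1 / 2 ^ (N ! + F + 5)) := by
          gcongr
          · exact hgiR 1
          · exact hgiR 2
      _ = (Hn : ℝ) * 10 / (2 ^ N ! * 2 ^ F * 32) := by rw [← hsplit]; ring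
      _ ≤ 2 ^ N ! * 10 / (2 ^ N ! * 2 ^ F * 32) := by gcongr
      _ ≤ 2 ^ N ! * 16 / (2 ^ N ! * 2 ^ F * 32) := by gcongr; norm_num
      _ = 1 / (2 : ℝ) ^ F / 2 := by field_simp; ring
  -- `|φ(g)| ≥ 1/2^{F+1}`
  set frm : ℝ := (g 0 : ℝ) + g 1 * liouvilleNumber 2 + g 2 * rhoArc with hfrm
  set Φ : ℝ := (g 0 : ℝ) + g 1 * partialSum 2 N + g 2 * ((arcProdQ N : ℚ) : ℝ) with hΦ
  have hfrm_low : 1 / (2 : ℝ) ^ F / 2 ≤ |frm| := by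
    have h1 : |Φ| - |frm - Φ| ≤ |frm| := by
      have := abs_sub_abs_le_abs_sub Φ frm
      rw [abs_sub_comm Φ frm] at this
      linarith
    linarith [hlow, happ.trans heps]
  -- the exponent: `F + 1 ≤ (1+H)^9`, `log 2 ≤ 1`
  have h9 : F + 2 ≤ (1 + Hn) ^ 9 := cutA_height_bound hHn1 hN5 hNmin
  have hgoal : Real.exp (-((1 + HR) ^ 9)) ≤ 1 / (2 : ℝ) ^ F / 2 := by
    have hE : ((F : ℝ) + 1) ≤ (1 + HR) ^ 9 := by
      rw [hHRn]
      have : ((F + 2 : ℕ) : ℝ) ≤ (((1 + Hn) ^ 9 : ℕ) : ℝ) := by exact_mod_cast h9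
      push_cast at this
      linarith
    have hlog2 : Real.log 2 ≤ 1 := by have := Real.log_two_lt_d9; linarith
    have e1 : 1 / (2 : ℝ) ^ F / 2 = Real.exp (-(((F + 1 : ℕ) : ℝ) * Real.log 2)) := by
      rw [Real.exp_neg, Real.exp_nat_mul, Real.exp_log two_pos, pow_succ]
      field_simp
    rw [e1, Real.exp_le_exp, neg_le_neg_iff]
    push_cast
    calc ((F : ℝ) + 1) * Real.log 2 ≤ ((F : ℝ) + 1) * 1 := mul_le_mul_of_nonneg_left hlog2 (by positivity)
      _ ≤ (1 + HR) ^ 9 := by rw [mul_one]; exact hE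
  exact hgoal.trans hfrm_low

/-- **(iii) `zA` has NO hyper-small integer forms** — the SECOND Diophantine binder of item 33364 (its TEXT, negated:
`¬ ∀ m, ∃ h ≠ 0, ‖Σ hᵢ zᵢ‖ < exp(−(1+Σ|hᵢ|)^m)`), refuted AT `m₀ = 10`: the putative hyper-small form at `m = 10` would be
`< exp(−X^10) ≤ exp(−X^9)` (monotonicity of `m ↦ X^m` for `X = 1 + Σ|hᵢ| ≥ 1`, USED via Mathlib `pow_le_pow_right₀`),
contradicting the form bound (M) at exponent `9` — HYPOTHESIS-FREE. -/
theorem not_hyperLinLiouville_zA : ¬ HyperLinLiouville zA := by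
  intro hH
  obtain ⟨g, hg, hlt⟩ := hH 10
  rw [norm_zA_form] at hlt
  have hlow := form_lower_bound_A g hg
  have hX : (1 : ℝ) ≤ 1 + ∑ i, (|g i| : ℝ) := by
    have : (0 : ℝ) ≤ ∑ i, (|g i| : ℝ) :=
      Finset.sum_nonneg fun i _ => by exact_mod_cast abs_nonneg (g i)
    linarith
  have hmono : (1 + ∑ i, (|g i| : ℝ)) ^ 9 ≤ (1 + ∑ i, (|g i| : ℝ)) ^ 10 :=
    pow_le_pow_right₀ hX (by norm_num)
  have := Real.exp_le_exp.mpr (neg_le_neg hmono)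
  linarith

/-- The exponent control: at `m = 9` itself the refutation is NOT claimed — what (M) gives is exactly the non-strict
opposite inequality `exp(−X^9) ≤ |φ(g)|` for every `g ≠ 0` (so no form is hyper-small at exponent `9` either; recorded as the
sharp edge of the certificate, the member's true hyper-order is not computed here). -/
theorem no_hyperSmall_form_at_nine (g : Fin 3 → ℤ) (hg : g ≠ 0) :
    ¬ ‖∑ i, (g i : ℂ) * zA i‖ < Real.exp (-((1 + ∑ i, (|g i| : ℝ)) ^ 9)) := by
  rw [norm_zA_form, not_lt]
  exact form_lower_bound_A g hg

/-- **(iii^π) `zA^π` has NO hyper-small integer forms** (refuted at `m = 10`; `π ≥ 1`) — HYPOTHESIS-FREE. -/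
theorem not_hyperLinLiouville_zApi : ¬ HyperLinLiouville zApi := by
  intro hH
  obtain ⟨g, hg, hlt⟩ := hH 10
  rw [norm_zApi_form] at hlt
  have hlow := form_lower_bound_A g hg
  have hX : (1 : ℝ) ≤ 1 + ∑ i, (|g i| : ℝ) := by
    have : (0 : ℝ) ≤ ∑ i, (|g i| : ℝ) :=
      Finset.sum_nonneg fun i _ => by exact_mod_cast abs_nonneg (g i)
    linarith
  have hmono : (1 + ∑ i, (|g i| : ℝ)) ^ 9 ≤ (1 + ∑ i, (|g i| : ℝ)) ^ 10 :=
    pow_le_pow_right₀ hX (by norm_num)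
  have := Real.exp_le_exp.mpr (neg_le_neg hmono)
  have hπ : (1 : ℝ) ≤ Real.pi := by have := Real.pi_gt_three; linarith
  have habs := abs_nonneg ((g 0 : ℝ) + g 1 * liouvilleNumber 2 + g 2 * rhoArc)
  nlinarith

/-- **`zA` lies in the scope of item 33364** — all three hypotheses as TEXT, HYPOTHESIS-FREE. -/
theorem zA_in_scope_33364 :
    LinearIndependent ℚ zA ∧
    (∀ ω : ℕ, ∃ h : Fin 3 → ℤ, h ≠ 0 ∧ ‖∑ i, (h i : ℂ) * zA i‖ < 1 / (1 + ∑ i, (|h i| : ℝ)) ^ ω) ∧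
    (¬ ∀ m : ℕ, ∃ h : Fin 3 → ℤ, h ≠ 0 ∧
      ‖∑ i, (h i : ℂ) * zA i‖ < Real.exp (-((1 + ∑ i, (|h i| : ℝ)) ^ m))) :=
  ⟨linearIndependent_zA, linLiouville_zA, not_hyperLinLiouville_zA⟩

/-- **`zA^π` lies in the scope of item 33364** — HYPOTHESIS-FREE. -/
theorem zApi_in_scope_33364 :
    LinearIndependent ℚ zApi ∧
    (∀ ω : ℕ, ∃ h : Fin 3 → ℤ, h ≠ 0 ∧ ‖∑ i, (h i : ℂ) * zApi i‖ < 1 / (1 + ∑ i, (|h i| : ℝ)) ^ ω) ∧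
    (¬ ∀ m : ℕ, ∃ h : Fin 3 → ℤ, h ≠ 0 ∧
      ‖∑ i, (h i : ℂ) * zApi i‖ < Real.exp (-((1 + ∑ i, (|h i| : ℝ)) ^ m))) :=
  ⟨linearIndependent_zApi, linLiouville_zApi, not_hyperLinLiouville_zApi⟩

/-- **`SB 3 zA` — HYPOTHESIS-FREE** (the arc wall at its member). -/
theorem sb_zA : SB 3 zA := sb_arcWall3

/-- **`SB 3 zA^π` — HYPOTHESIS-FREE.** -/
theorem sb_zApi : SB 3 zApi := sb_arcWall3_pi

/-- **ITEM 33364 DECIDED AT `zA` — HYPOTHESIS-FREE:** scope (i)–(iii) AND the conclusion. -/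
theorem finiteOrderLiouvilleSchanuel_at_zA :
    LinearIndependent ℚ zA ∧ LinLiouville zA ∧ ¬ HyperLinLiouville zA ∧ SB 3 zA :=
  ⟨linearIndependent_zA, linLiouville_zA, not_hyperLinLiouville_zA, sb_zA⟩

/-- **ITEM 33364 DECIDED AT `zA^π` — HYPOTHESIS-FREE.** -/
theorem finiteOrderLiouvilleSchanuel_at_zApi :
    LinearIndependent ℚ zApi ∧ LinLiouville zApi ∧ ¬ HyperLinLiouville zApi ∧ SB 3 zApi :=
  ⟨linearIndependent_zApi, linLiouville_zApi, not_hyperLinLiouville_zApi, sb_zApi⟩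

/-- **THE LIVE ITEM 33364 APPLIED at `zA`** (its text VERBATIM as the hypothesis; the member discharges every binder). -/
theorem item33364_at_zA
    (h33364 : ∀ (n : ℕ) (z : Fin n → ℂ), LinearIndependent ℚ z →
      (∀ ω : ℕ, ∃ h : Fin n → ℤ, h ≠ 0 ∧ ‖∑ i, (h i : ℂ) * z i‖ < 1 / (1 + ∑ i, (|h i| : ℝ)) ^ ω) →
      (¬ ∀ m : ℕ, ∃ h : Fin n → ℤ, h ≠ 0 ∧
        ‖∑ i, (h i : ℂ) * z i‖ < Real.exp (-((1 + ∑ i, (|h i| : ℝ)) ^ m))) →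
      (n : Cardinal) ≤ Algebra.trdeg ℚ
        ↥(IntermediateField.adjoin ℚ (Set.range z ∪ Set.range (Complex.exp ∘ z)))) :
    SB 3 zA := h33364 3 zA linearIndependent_zA linLiouville_zA not_hyperLinLiouville_zA

/-- **THE LIVE ITEM 33364 APPLIED at `zA^π`.** -/
theorem item33364_at_zApi
    (h33364 : ∀ (n : ℕ) (z : Fin n → ℂ), LinearIndependent ℚ z →
      (∀ ω : ℕ, ∃ h : Fin n → ℤ, h ≠ 0 ∧ ‖∑ i, (h i : ℂ) * z i‖ < 1 / (1 + ∑ i, (|h i| : ℝ)) ^ ω) →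
      (¬ ∀ m : ℕ, ∃ h : Fin n → ℤ, h ≠ 0 ∧
        ‖∑ i, (h i : ℂ) * z i‖ < Real.exp (-((1 + ∑ i, (|h i| : ℝ)) ^ m))) →
      (n : Cardinal) ≤ Algebra.trdeg ℚ
        ↥(IntermediateField.adjoin ℚ (Set.range z ∪ Set.range (Complex.exp ∘ z)))) :
    SB 3 zApi := h33364 3 zApi linearIndependent_zApi linLiouville_zApi not_hyperLinLiouville_zApi

/-- `zA` is ALSO in the scope of item 31077 (`ℓ₂ ∈ span`, Liouville) — bookkeeping, hyp-free. -/
theorem coordLiouvilleSpan_zA : ∃ w ∈ Submodule.span ℚ (Set.range zA), Liouville w.re ∨ Liouville w.im :=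
  ⟨zA 1, Submodule.subset_span ⟨1, rfl⟩, Or.inl (by simpa [zA] using liouville_liouvilleNumber (le_refl 2))⟩

/-- **ITEM 31077 at `zA`** (its text verbatim as the hypothesis) — bookkeeping; the conclusion is `sb_zA` outright. -/
theorem item31077_at_zA
    (h31077 : ∀ (n : ℕ) (z : Fin n → ℂ), LinearIndependent ℚ z →
      (∃ w ∈ Submodule.span ℚ (Set.range z), Liouville w.re ∨ Liouville w.im) →
      (n : Cardinal) ≤ Algebra.trdeg ℚ
        ↥(IntermediateField.adjoin ℚ (Set.range z ∪ Set.range (Complex.exp ∘ z)))) :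
    SB 3 zA := h31077 3 zA linearIndependent_zA coordLiouvilleSpan_zA

end Members

end Summit.Schanuel.Schanuel.Theorems.RootDecomp1KArcCell

end
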